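import Mathlib
import HarnessLib
import Summits.HubbardSuperconductivity.HubbardSuperconductivity.Theorems.WeakCouplingBCSKlCertTPrimePocketAnalytic

/-!
# Route `WeakCouplingBCS` — certificate vocabulary for `WcbcsKohnLuttingerB1g` (stmt-HubbardSuperconductivity-0158):
# the ANALYTIC side of a `t′` hole-pocket certificate row keyed on the HILBERT–SCHMIDT row of `χ₀` (not on a sup bound)

Cell `gate-hubbard-kl`, seat p4 (g23); zero kit; item «(E2)-TPRIME-LINDHARD-BOUND» of pen (R460)(A), scope memo `HOME/prover-p4/E2-TPRIME-LINDHARD-SCOPE.md`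
§1.  By decl the `χ₀` hypothesis of `kltp_pocket_analytic_of_chi0Sup` / `kltp_window_U_of_chi0Sup` (margin-1 g18, p723866) enters ONLY through
`klph_memLp_kernel_of_bound … hC : MemLp (fun z => χ₀ (z.1 + z.2)) 2 (σ ⊗ σ)` with `C` free (crit-1 g4 ⟨♭⟩): the object the soundness chain consumes is the
Hilbert–Schmidt property of the Lindhard kernel on `F × F`, of which a sup bound is one sufficient condition — and the tree's `t′ = 0` leaf of record
(`stub_klKernelHS`, via `Literature…memLp_lindhardKernelPolar`) is Hilbert–Schmidt too, not a sup bound.  This file states the two consumers on the WEAKER face: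

* `kltp_pocket_analytic_of_HS` — `KLTPAnalytic (squareDispersion 1 t′) μ` on the hole-pocket window from `hHS : MemLp (χ₀(·+·)) 2 (σ⊗σ)` alone;
* `kltp_window_U_of_HS` — an accepted record (`checkB1gD`) whose boxes lie in the window, an HS row per box and `EnclosuresB1gTP c t′` give
  `KLB1gDominatesTP t′ mub mua gamma`;
* `kltp_HS_of_chi0Sup` — the sup row implies the HS row (so nothing keyed on the sup face is lost).

No definitions; nothing here asserts an HS row, a record, a margin, `K₃`, `U₀`, the window or superconductivity; a Kohn–Luttinger `O(U²)` channel statement is not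
ODLRO; nothing here proves superconductivity in the Hubbard model.
References: S. Raghu, S. A. Kivelson, D. J. Scalapino, Phys. Rev. B 81 (2010) 224505, §II (5)–(8), §III (17).
-/

noncomputable section

-- the tree's namespace `Summit.<Summit>.<Problem>.Theorems` repeats the summit name by design (D-0017)
set_option linter.dupNamespace false

namespace Summit.HubbardSuperconductivity.HubbardSuperconductivity.Theorems

open MeasureTheory Set Real CwKLChiralWindow Literature.MathematicalPhysics.QuantumLattice
open scoped ENNReal NNReal

/-- **The sup row implies the Hilbert–Schmidt row** on the hole-pocket window (finiteness of `σ` from the generic speed floor). [cite: RaghuKivelsonScalapino2010, §II (7)] -/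
theorem kltp_HS_of_chi0Sup {tp μ : ℝ} (htp1 : -1 / 2 < tp) (htp2 : tp < 0) (hμ1 : 4 * tp < μ) (hμ2 : μ < 0)
    (hH : (1 - tp * μ) * (1 + 4 * tp ^ 2) ≤ (1 - 4 * tp ^ 2) * (1 - 2 * tp)) {C : ℝ}
    (hC : ∀ k ∈ fermiCurve (squareDispersion 1 tp) μ, ∀ k' ∈ fermiCurve (squareDispersion 1 tp) μ,
      |lindhardFunction (squareDispersion 1 tp) μ (k + k')| ≤ C) :
    MemLp (fun z : Momentum × Momentum => lindhardFunction (squareDispersion 1 tp) μ (z.1 + z.2)) 2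
      ((fermiCurveMeasure (squareDispersion 1 tp) μ).prod (fermiCurveMeasure (squareDispersion 1 tp) μ)) := by
  haveI : IsFiniteMeasure (fermiCurveMeasure (squareDispersion 1 tp) μ) := kltp_isFiniteMeasure_pocket htp1 htp2 hμ1 hμ2.le hH
  exact klph_memLp_kernel_of_bound (measurable_squareDispersion 1 tp) μ hC

/-- **The analytic side of a hole-pocket certificate row from the HILBERT–SCHMIDT row alone** (every `−1/2 < t′ < 0`, `4t′ < μ < 0`,
`(1 − t′μ)(1 + 4t′²) ≤ (1 − 4t′²)(1 − 2t′)`): finiteness from the generic speed floor, the `D₄` rows (theorems), channel states from the arc.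
[cite: RaghuKivelsonScalapino2010, §II (5)-(8) and §III (17)] -/
theorem kltp_pocket_analytic_of_HS {tp μ : ℝ} (htp1 : -1 / 2 < tp) (htp2 : tp < 0) (hμ1 : 4 * tp < μ) (hμ2 : μ < 0)
    (hH : (1 - tp * μ) * (1 + 4 * tp ^ 2) ≤ (1 - 4 * tp ^ 2) * (1 - 2 * tp))
    (hHS : MemLp (fun z : Momentum × Momentum => lindhardFunction (squareDispersion 1 tp) μ (z.1 + z.2)) 2
      ((fermiCurveMeasure (squareDispersion 1 tp) μ).prod (fermiCurveMeasure (squareDispersion 1 tp) μ))) :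
    KLTPAnalytic (squareDispersion 1 tp) μ :=
  klTPAnalytic_of tp μ (kltp_isFiniteMeasure_pocket htp1 htp2 hμ1 hμ2.le hH) hHS (kltp_pocket_channelStates_nonempty htp1 htp2 hμ1 hμ2 hH)

/-- **The `t′` window statement from the HILBERT–SCHMIDT rows and the enclosures alone** (generic in the record). [cite: RaghuKivelsonScalapino2010, §II (7), (13) and §III Fig. 3] -/
theorem kltp_window_U_of_HS (tp : ℝ) (c : KLCert) (hc : c.checkB1gD = true) (htp1 : -1 / 2 < tp) (htp2 : tp < 0)
    (hwin : ∀ bx ∈ c.boxes, ∀ μ ∈ Set.Icc (bx.mulo : ℝ) (bx.muhi : ℝ),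
      4 * tp < μ ∧ μ < 0 ∧ (1 - tp * μ) * (1 + 4 * tp ^ 2) ≤ (1 - 4 * tp ^ 2) * (1 - 2 * tp))
    (hHS : ∀ bx ∈ c.boxes, ∀ μ ∈ Set.Icc (bx.mulo : ℝ) (bx.muhi : ℝ),
      MemLp (fun z : Momentum × Momentum => lindhardFunction (squareDispersion 1 tp) μ (z.1 + z.2)) 2
        ((fermiCurveMeasure (squareDispersion 1 tp) μ).prod (fermiCurveMeasure (squareDispersion 1 tp) μ)))
    (hE : c.EnclosuresB1gTP tp) :
    KLB1gDominatesTP tp ((c.mub : ℚ) : ℝ) ((c.mua : ℚ) : ℝ) ((c.gamma : ℚ) : ℝ) :=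
  kltp_window_U tp c hc (fun bx hbx μ hμ =>
    kltp_pocket_analytic_of_HS htp1 htp2 (hwin bx hbx μ hμ).1 (hwin bx hbx μ hμ).2.1 (hwin bx hbx μ hμ).2.2 (hHS bx hbx μ hμ)) hE

end Summit.HubbardSuperconductivity.HubbardSuperconductivity.Theorems

end
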